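import Summits.BirchSwinnertonDyer.BirchSwinnertonDyer.Theorems.EisensteinPrimesMazurMCOnCellBTwistbackSubrowPartner
import Summits.BirchSwinnertonDyer.Rank1Residual.X2.ResidualLineCharactersOdd
import Summits.BirchSwinnertonDyer.Rank1Residual.X2.IsogenyLineType
import Literature.NumberTheory.EllipticCurves.Rank1Residual.GVParityTwistProofs
import Literature.NumberTheory.EllipticCurves.TateCurve.NumberFieldUniformization
import Literature.NumberTheory.EllipticCurves.TateCurve.NumberFieldUniformizationTwisted
import HarnessLib

/-!
# Crux 3 `MazurMCOnCellB` (stmt-BirchSwinnertonDyer-19033), line `twistback` v4 — the SUB-ROW ASSEMBLY, part 3c: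
# stub 6 (∃-PARTNER) AT EVERY NON-SPLIT X2b PAIR `(W, 3)` OF LOCAL BALANCE ONE — for ANY rational `3`-line of `W`
# (its Greenberg–Vatsal shape is DERIVED from `¬GVPar`), and with the line datum EXISTENTIAL («c(E) = 1»)

LEAD bsd-line-x2-p1 g11 (2026-08-28). HONEST FRAMING (cell `bsd-eis`, run/shared/lean/pub/bsd-eis/): conditional
theorems only; named facts BY NAME as in part 3b (`…TwistbackSubrowPartner`, p655083): `PublishedInputs`, Disegni 2020
Thm. 4(1), Greenberg–Vatsal Thm. (3.11), Dokchitser–Dokchitser Thm. 1.4, Nakagawa–Horie–Taya (all PUB) and Keller–Yin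
Thm. E (`thmE_pConverse_semistable_OPEN`, PREPRINT). `--supports` stmt-BirchSwinnertonDyer-19033; no `def`, no `sorry`;
closes no registered stub; no summit statement, no Mazur main conjecture and no BSD proved for any curve
unconditionally; 0 cells / labels / tiers move.

WHY. Part 3b serves a line datum OF A GIVEN SHAPE (ramified-odd with `3 ∣ m`, `3 ∤ d`, or unramified-even with the
divisibilities swapped). Those four side conditions are CONSEQUENCES of `X2.CellB W 3` (= `r_an = 0 ∧ ClassX2 ∧
¬GVPar`): a rational line is even or odd (tree `lineEven_or_lineOdd`), so `¬GVPar` makes a ramified line odd and an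
unramified line even; the Tate line at `3 ‖ N` (tree `X2.IsogenyLineType.exists_tateLine_adicCompletionPrime`, Tate
facts DISCHARGED by `TateCurve.Silverman1994_thmV53_*_holds`) gives `3 ∣ m`, `3 ∤ d` for a ramified line (tree
`X2.ResidualLineCharacters.{dvd,not_dvd}_level_of_not_lineUnramifiedAt`) and `3 ∣ d` for an unramified one (tree
`X2.ResidualLineCharactersOdd.dvd_level_quot_of_lineUnramifiedAt`), while `3 ∤ m` for an unramified line is the
conductor criterion (tree `X2.PrimeOrderCharacters.not_dvd_level_of_isPrimitive_of_forall_mem_inertia`). And the line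
datum itself EXISTS for every X2 curve (tree, Kronecker–Weber PROVED: `Rank1Residual.exists_isRationalLine_of_not_irr`,
`X2.ResidualLineCharacters.exists_character_sub/_quot`) — so the ONLY per-pair input of the sub-row is the local
balance («c(E) = 1»), here an existential over line data.

* §1 `not_dvd_level_of_lineUnramifiedAt_of_line` — `3 ∤ m` for the character of an UNRAMIFIED line (line-side form).
* §2 **`upperPartner_at_three_of_line_of_thmE`** — for `W` with `X2.CellB W 3`, `3` non-split, ANY rational `3`-line
  `Φ₀` with its primitive characters `(φ, ψ)` and a finite set of places `S₀ ∌ (3)` off which `W` is good with LOCAL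
  BALANCE ONE: the conclusion of `stub_upperPartner` at `(W, 3)` VERBATIM.
* §3 **`upperPartner_at_three_of_balanceOne_of_thmE`** — the same with the line datum EXISTENTIAL: «some rational
  `3`-line with primitive characters and some `S₀ ∌ (3)` (good reduction off `S₀ ∪ {3}`) have balance `1`» — i.e.
  stub 6 ON THE WHOLE SUB-ROW «`p = 3`, non-split, `c(E) = 1`» of row A10 (census: 30 of the 44 non-split cells).

References: [GreenbergVatsal2000] Thm. (1.3), §2 pp. 26–28, §3 Thm. (3.11); [GreenbergLNM1716] Prop. 5.10;
[SilvermanATAEC1994] Thm. V.5.3, Cor. V.5.4; [Washington1997] Ch. 3, Thm. 14.1; [NakagawaHorie1988] Thm. 1;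
[KellerYin2024] Thm. E (PRE); [DokchitserDokchitserAnnals2010] Thm. 1.4; [Disegni2020] Thm. 4; [Wuthrich2014] Thm. 16.
-/

set_option autoImplicit false

-- `Summit.BirchSwinnertonDyer.BirchSwinnertonDyer.…`: the summit and its single sub-problem share a name.
set_option linter.dupNamespace false

noncomputable section

open scoped Classical MatrixGroups ModularForm NumberTheorySymbols

open CongruenceSubgroup WeierstrassCurve NumberField IsDedekindDomain Field DirichletCharacter Rat.HeightOneSpectrum
  Literature.NumberTheory.EllipticCurves Literature.NumberTheory.GaloisRepresentations
  Literature.NumberTheory.EllipticCurves.ModularForms Literature.NumberTheory.QuadraticFields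
  Literature.NumberTheory.EllipticCurves.Rank1Residual Literature.NumberTheory.EllipticCurves.Rank1Residual.Typed
  Literature.NumberTheory.EllipticCurves.Wuthrich2014 Literature.NumberTheory.EllipticCurves.GreenbergVatsal2000
  Literature.NumberTheory.EllipticCurves.Disegni2020 Literature.NumberTheory.EllipticCurves.KellerYin2024
  Literature.NumberTheory.EllipticCurves.KrizLi2019 Literature.NumberTheory.LFunctions
  Summit.BirchSwinnertonDyer.Rank1Residual Summit.BirchSwinnertonDyer.Rank1Residual.X2
  Summit.BirchSwinnertonDyer.BirchSwinnertonDyer.Theses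
  Summit.BirchSwinnertonDyer.BirchSwinnertonDyer.Theorems.EisensteinPrimesLineWeilRelation
  Summit.BirchSwinnertonDyer.BirchSwinnertonDyer.Theorems.EisensteinPrimesMazurMCOnCellBTwistbackKLFlatPartner
  Summit.BirchSwinnertonDyer.BirchSwinnertonDyer.Theorems.EisensteinPrimesMazurMCOnCellBTwistbackLamOnePartner
  Summit.BirchSwinnertonDyer.BirchSwinnertonDyer.Theorems.EisensteinPrimesMazurMCOnCellBTwistbackSubrowCarrier
  Summit.BirchSwinnertonDyer.BirchSwinnertonDyer.Theorems.EisensteinPrimesMazurMCOnCellBTwistbackSubrowCarrierEven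
  Summit.BirchSwinnertonDyer.BirchSwinnertonDyer.Theorems.EisensteinPrimesMazurMCOnCellBTwistbackKLFieldSupply
  Summit.BirchSwinnertonDyer.BirchSwinnertonDyer.Theorems.EisensteinPrimesMazurMCOnCellBTwistbackKLFieldSupplyClassNumber
  Summit.BirchSwinnertonDyer.BirchSwinnertonDyer.Theorems.EisensteinPrimesMazurMCOnCellBTwistbackPartnerClassNumberLift
  Summit.BirchSwinnertonDyer.BirchSwinnertonDyer.Theorems.EisensteinPrimesLinePsiAtMultiplicativePrime
  Summit.BirchSwinnertonDyer.BirchSwinnertonDyer.Theorems.EisensteinPrimesLinePhiAtMultiplicativePrime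

  Summit.BirchSwinnertonDyer.BirchSwinnertonDyer.Theorems.EisensteinPrimesMazurMCOnCellBTwistbackSubrowPartnerGiven
  Summit.BirchSwinnertonDyer.BirchSwinnertonDyer.Theorems.EisensteinPrimesMazurMCOnCellBTwistbackSubrowPartner
  Summit.BirchSwinnertonDyer.BirchSwinnertonDyer.Theorems.EisensteinPrimesLineCharactersAtMultiplicativePlace
  Summit.BirchSwinnertonDyer.Rank1Residual.X2.ResidualLineCharacters
  Summit.BirchSwinnertonDyer.Rank1Residual.X2.ResidualLineCharactersOdd
  Summit.BirchSwinnertonDyer.Rank1Residual.X2.PrimeOrderCharacters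
  Literature.NumberTheory.EllipticCurves.TateCurve

namespace Summit.BirchSwinnertonDyer.BirchSwinnertonDyer.Theorems.EisensteinPrimesMazurMCOnCellBTwistbackSubrowPartnerAnyLine

variable {W : WeierstrassCurve ℚ} [W.IsElliptic] {p : ℕ} [hp : Fact p.Prime]

/-! ## §1. The character of an UNRAMIFIED line has level prime to `p` (line-side form) -/

omit [W.IsElliptic] in
/-- **`p ∤ m` for the primitive character `φ` of a rational line UNRAMIFIED at `p`**, stated on `Φ₀` itself (the
tree's `X2.ResidualLineCharactersOdd.not_dvd_level_sub_of_lineUnramifiedAt` is the same fact on the transported line):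
every inertia group above `p` fixes a non-zero `P ∈ Φ₀`, so `φ(χ_m(τ)) = 1` there, and the conductor criterion
(`X2.PrimeOrderCharacters.not_dvd_level_of_isPrimitive_of_forall_mem_inertia`) applies.
[cite: GreenbergLNM1716, Prop. 5.10 (proof, PDF p. 148)] [cite: Washington1997, Ch. 3 (p. 21: p ramifies iff p ∣ f_χ)] -/
theorem not_dvd_level_of_lineUnramifiedAt_of_line {Φ₀ : AddSubgroup (geomTorsion W (p : ℤ))}
    (hΦ : IsRationalLine W p Φ₀) (hunr : LineUnramifiedAt W p Φ₀)
    {m : ℕ} [NeZero m] {φ : DirichletCharacter (ZMod p) m} (hφ : φ.IsPrimitive)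
    (hφ0 : ∀ (σ : absoluteGaloisGroup ℚ), ∀ P ∈ Φ₀,
      σ • P = (φ ((modNCyclotomicCharacter ℚ m σ : (ZMod m)ˣ) : ZMod m)).val • P) :
    ¬ p ∣ m := by
  haveI : NeZero p := ⟨hp.out.ne_zero⟩
  obtain ⟨v, hv⟩ :=
    Literature.NumberTheory.NumberFields.RingOfIntegers.exists_heightOneSpectrum_natCast_mem ℚ hp.out
  obtain ⟨P, hP, hP0⟩ := ResidualLineRigidity.exists_ne_zero_mem hΦ.1
  refine not_dvd_level_of_isPrimitive_of_forall_mem_inertia hφ hp.out hv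
    (adicCompletionPrime_mem_primesAbove ℚ v) fun τ hτ ↦ ?_
  have h1 : τ • P = (1 : ℤ) • P := by
    rw [one_zsmul]
    exact hunr v hv _ (adicCompletionPrime_mem_primesAbove ℚ v) τ hτ P hP
  have h := natCast_eq_intCast_of_smul_eq_of_ne_zero hP0 h1 (hφ0 τ P hP)
  rwa [ZMod.natCast_zmod_val, Int.cast_one] at h

/-! ## §2. `p = 3`, ANY rational line: the Greenberg–Vatsal shape is derived from `¬GVPar` -/

/-- **Stub 6 (∃-PARTNER) at EVERY non-split X2b pair `(W, 3)`, for ANY rational `3`-line `Φ₀` with its primitive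
characters and a local balance ONE — `K` CHOSEN.** `X2.CellB W 3` contains `¬GVPar W 3`: with `lineEven_or_lineOdd`
the line is ramified-odd or unramified-even; the Tate line at `3 ‖ N` (`exists_tateLine_adicCompletionPrime`, Tate
facts discharged) yields `3 ∣ m ∧ 3 ∤ d` resp. `3 ∤ m ∧ 3 ∣ d`; then part 3b's
`upperPartner_at_three_of_{ramifiedOdd,unramifiedEven}_of_thmE`. Inputs BY NAME: `PublishedInputs`, Disegni Thm. 4(1),
GV Thm. (3.11), Dokchitser, Nakagawa–Horie–Taya (PUB); Keller–Yin Thm. E (PRE). [claim: KellerYin2024, status: under-review]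
[cite: GreenbergVatsal2000, Thm. (1.3) and §2 pp. 26–28] [cite: SilvermanATAEC1994, Thm. V.5.3 and Cor. V.5.4]
[cite: NakagawaHorie1988, Thm. 1] [cite: DokchitserDokchitserAnnals2010, Thm. 1.4] [cite: Wuthrich2014, Thm. 16 (p. 397)] -/
theorem upperPartner_at_three_of_line_of_thmE (hP : EisensteinPrimes.PublishedInputs)
    (hDis : padicBSD_rankOne_nonsplitMult) (h311 : thm311_hasUnitContent_iff_and_order_eq_of_lineRamifiedEven)
    (hDD : ∀ (V : WeierstrassCurve ℚ) [V.IsElliptic] (ℓ : ℕ) [Fact ℓ.Prime], selmerCorank_mod_two_eq V ℓ)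
    (hKY : thmE_pConverse_semistable_OPEN)
    (hNH : Literature.NumberTheory.QuadraticFields.nakagawaHorie_taya_exists_imaginary_h3_eq_one)
    (W : WeierstrassCurve ℚ) [W.IsElliptic] [W.IsGloballyMinimal]
    (hc : X2.CellB W 3) (hns : ¬ W.HasSplitMultiplicativeReductionAtPrime 3)
    {Φ₀ : AddSubgroup (geomTorsion W (3 : ℤ))} (hΦ : IsRationalLine W 3 Φ₀)
    {m : ℕ} [NeZero m] (φ : DirichletCharacter (ZMod 3) m) {d : ℕ} [NeZero d]
    (ψ : DirichletCharacter (ZMod 3) d) (hφ : φ.IsPrimitive) (hψ : ψ.IsPrimitive)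
    (hφ0 : ∀ (σ : absoluteGaloisGroup ℚ), ∀ P ∈ Φ₀,
      σ • P = (φ ((modNCyclotomicCharacter ℚ m σ : (ZMod m)ˣ) : ZMod m)).val • P)
    (hψ0 : ∀ (σ : absoluteGaloisGroup ℚ) (P : geomTorsion W (3 : ℤ)),
      σ • P - (ψ ((modNCyclotomicCharacter ℚ d σ : (ZMod d)ˣ) : ZMod d)).val • P ∈ Φ₀)
    (S₀ : Finset (HeightOneSpectrum (𝓞 ℚ))) (hS₀p : ∀ v ∈ S₀, ((3 : ℕ) : 𝓞 ℚ) ∉ v.asIdeal)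
    (hS : ∀ v : HeightOneSpectrum (𝓞 ℚ), v ∉ S₀ → ((3 : ℕ) : 𝓞 ℚ) ∉ v.asIdeal → W.HasGoodReductionAt v)
    (hbal : 1 + ∑ v ∈ S₀, delta W 3 v =
      ∑ v ∈ S₀, ((if φ (Rat.HeightOneSpectrum.natGenerator v : ZMod m) =
            (Rat.HeightOneSpectrum.natGenerator v : ZMod 3)
          then sFactor 3 (Rat.HeightOneSpectrum.natGenerator v) else 0) +
        (if ψ (Rat.HeightOneSpectrum.natGenerator v : ZMod d) =
            (Rat.HeightOneSpectrum.natGenerator v : ZMod 3)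
          then sFactor 3 (Rat.HeightOneSpectrum.natGenerator v) else 0))) :
    ∃ (K : Type) (_ : Field K) (_ : NumberField K), IsImaginaryQuadratic K ∧
      SatisfiesHeegnerHypothesis (W.conductorNorm ℤ) K ∧ SatisfiesHeegnerHypothesis 3 K ∧
      Odd (NumberField.discr K) ∧ NumberField.discr K < -4 ∧
      (W.quadraticTwist (NumberField.discr K : ℚ)).analyticRank = 1 ∧
      ∀ (Wd : WeierstrassCurve ℚ) [Wd.IsElliptic] [Wd.IsGloballyMinimal],
        (∃ C : VariableChange ℚ, C • Wd = W.quadraticTwist (NumberField.discr K : ℚ)) →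
        MissingUpperBoundAt Wd 3 := by
  have hngv : ¬ GVPar W 3 := hc.2.2
  have hTate := IsogenyLineType.exists_tateLine_adicCompletionPrime W 3
    Silverman1994_thmV53_tateUniformisation_holds Silverman1994_thmV53_corV54_tateUniformisation_holds (by decide)
    hc.2.1.2.2
  rcases em (LineUnramifiedAt W 3 Φ₀) with hunr | hram
  · -- unramified ⟹ even (else GVPar), `3 ∤ m`, `3 ∣ d`
    have heven : LineEven W 3 Φ₀ :=
      (lineEven_or_lineOdd hΦ).resolve_right fun hodd ↦ hngv ⟨Φ₀, hΦ, Or.inr ⟨hunr, hodd⟩⟩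
    have hpm : ¬ 3 ∣ m := not_dvd_level_of_lineUnramifiedAt_of_line hΦ hunr hφ hφ0
    have hpd : 3 ∣ d := ResidualLineCharactersOdd.dvd_level_quot_of_lineUnramifiedAt hΦ hTate hunr hψ0
    exact upperPartner_at_three_of_unramifiedEven_of_thmE W hP hDis h311 hDD hKY hNH hc hns hΦ hunr heven φ ψ hφ hψ
      hpm hpd hφ0 hψ0 S₀ hS₀p hS hbal
  · -- ramified ⟹ odd (else GVPar), `3 ∣ m`, `3 ∤ d`
    have hodd : LineOdd W 3 Φ₀ :=
      (lineEven_or_lineOdd hΦ).resolve_left fun hev ↦ hngv ⟨Φ₀, hΦ, Or.inl ⟨hram, hev⟩⟩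
    have hpm : 3 ∣ m := ResidualLineCharacters.dvd_level_of_not_lineUnramifiedAt hΦ hTate hram hφ0
    have hpd : ¬ 3 ∣ d :=
      ResidualLineCharacters.not_dvd_level_of_not_lineUnramifiedAt hΦ hTate hram hψ
        fun σ y ↦ ResidualLineCharacters.smul_quot_eq_of_forall_mem hΦ (hψ0 σ) y
    exact upperPartner_at_three_of_ramifiedOdd_of_thmE W hP hDis h311 hDD hKY hNH hc hns hΦ hram hodd φ ψ hφ hψ hpm
      hpd hφ0 hψ0 S₀ hS₀p hS hbal

/-! ## §3. The line datum EXISTENTIAL: stub 6 on the sub-row «p = 3, non-split, c(E) = 1» -/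

/-- **Stub 6 (∃-PARTNER) at EVERY non-split X2b pair `(W, 3)` of LOCAL BALANCE ONE** — the hypothesis is now the
existential «SOME rational `3`-line of `W` with SOME primitive characters `(φ, ψ)` and SOME finite set of places
`S₀ ∌ (3)`, off which `W` is good away from `3`, has balance `1 + Σ_{S₀} δ_W = Σ_{S₀} (s[φ(ℓ)=ℓ̄] + s[ψ(ℓ)=ℓ̄])`»
(«c(E) = 1»; a rational line with primitive characters EXISTS for every X2 curve by the tree's Kronecker–Weber —
`Rank1Residual.exists_isRationalLine_of_not_irr`, `X2.ResidualLineCharacters.exists_character_sub/_quot` — so the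
content of the hypothesis is the VALUE of the balance). Conclusion: `stub_upperPartner`'s body at `(W, 3)` VERBATIM.
Inputs BY NAME as in §2. [claim: KellerYin2024, status: under-review] [cite: GreenbergVatsal2000, Thm. (1.3), §2 p. 28 and §3 Thm. (3.11)]
[cite: NakagawaHorie1988, Thm. 1] [cite: DokchitserDokchitserAnnals2010, Thm. 1.4] [cite: Disegni2020, Thm. 4 (§3.2)] -/
theorem upperPartner_at_three_of_balanceOne_of_thmE (hP : EisensteinPrimes.PublishedInputs)
    (hDis : padicBSD_rankOne_nonsplitMult) (h311 : thm311_hasUnitContent_iff_and_order_eq_of_lineRamifiedEven)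
    (hDD : ∀ (V : WeierstrassCurve ℚ) [V.IsElliptic] (ℓ : ℕ) [Fact ℓ.Prime], selmerCorank_mod_two_eq V ℓ)
    (hKY : thmE_pConverse_semistable_OPEN)
    (hNH : Literature.NumberTheory.QuadraticFields.nakagawaHorie_taya_exists_imaginary_h3_eq_one)
    (W : WeierstrassCurve ℚ) [W.IsElliptic] [W.IsGloballyMinimal]
    (hc : X2.CellB W 3) (hns : ¬ W.HasSplitMultiplicativeReductionAtPrime 3)
    (hbal : ∃ (Φ₀ : AddSubgroup (geomTorsion W (3 : ℤ))) (m : ℕ) (_ : NeZero m) (φ : DirichletCharacter (ZMod 3) m)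
        (d : ℕ) (_ : NeZero d) (ψ : DirichletCharacter (ZMod 3) d) (S₀ : Finset (HeightOneSpectrum (𝓞 ℚ))),
      IsRationalLine W 3 Φ₀ ∧ φ.IsPrimitive ∧ ψ.IsPrimitive ∧
      (∀ (σ : absoluteGaloisGroup ℚ), ∀ P ∈ Φ₀,
        σ • P = (φ ((modNCyclotomicCharacter ℚ m σ : (ZMod m)ˣ) : ZMod m)).val • P) ∧
      (∀ (σ : absoluteGaloisGroup ℚ) (P : geomTorsion W (3 : ℤ)),
        σ • P - (ψ ((modNCyclotomicCharacter ℚ d σ : (ZMod d)ˣ) : ZMod d)).val • P ∈ Φ₀) ∧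
      (∀ v ∈ S₀, ((3 : ℕ) : 𝓞 ℚ) ∉ v.asIdeal) ∧
      (∀ v : HeightOneSpectrum (𝓞 ℚ), v ∉ S₀ → ((3 : ℕ) : 𝓞 ℚ) ∉ v.asIdeal → W.HasGoodReductionAt v) ∧
      1 + ∑ v ∈ S₀, delta W 3 v =
        ∑ v ∈ S₀, ((if φ (Rat.HeightOneSpectrum.natGenerator v : ZMod m) =
              (Rat.HeightOneSpectrum.natGenerator v : ZMod 3)
            then sFactor 3 (Rat.HeightOneSpectrum.natGenerator v) else 0) +
          (if ψ (Rat.HeightOneSpectrum.natGenerator v : ZMod d) =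
              (Rat.HeightOneSpectrum.natGenerator v : ZMod 3)
            then sFactor 3 (Rat.HeightOneSpectrum.natGenerator v) else 0))) :
    ∃ (K : Type) (_ : Field K) (_ : NumberField K), IsImaginaryQuadratic K ∧
      SatisfiesHeegnerHypothesis (W.conductorNorm ℤ) K ∧ SatisfiesHeegnerHypothesis 3 K ∧
      Odd (NumberField.discr K) ∧ NumberField.discr K < -4 ∧
      (W.quadraticTwist (NumberField.discr K : ℚ)).analyticRank = 1 ∧
      ∀ (Wd : WeierstrassCurve ℚ) [Wd.IsElliptic] [Wd.IsGloballyMinimal],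
        (∃ C : VariableChange ℚ, C • Wd = W.quadraticTwist (NumberField.discr K : ℚ)) →
        MissingUpperBoundAt Wd 3 := by
  obtain ⟨Φ₀, m, im, φ, d, id, ψ, S₀, hΦ, hφ, hψ, hφ0, hψ0, hS₀p, hS, hb⟩ := hbal
  exact upperPartner_at_three_of_line_of_thmE hP hDis h311 hDD hKY hNH W hc hns hΦ φ ψ hφ hψ hφ0 hψ0 S₀ hS₀p hS hb

/-- **The line datum exists** (for the record; Kronecker–Weber is PROVED in the tree): every X2 curve at `p` has a
rational `p`-line with PRIMITIVE Dirichlet characters on the line and on the quotient, in the binder shape of the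
doors — so in `upperPartner_at_three_of_balanceOne_of_thmE` the only arithmetic content of the hypothesis is the value
`1` of the balance. [cite: GreenbergVatsal2000, §2 p. 28 ("G_ℚ acts on Φ by a character φ … and on Ψ by ψ")]
[cite: Washington1997, Thm. 14.1 (Kronecker–Weber) and Ch. 3] -/
theorem exists_lineDatum_of_classX2 (W : WeierstrassCurve ℚ) [W.IsElliptic] (hX : ClassX2 W p) :
    ∃ (Φ₀ : AddSubgroup (geomTorsion W (p : ℤ))) (m : ℕ) (_ : NeZero m) (φ : DirichletCharacter (ZMod p) m)
        (d : ℕ) (_ : NeZero d) (ψ : DirichletCharacter (ZMod p) d),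
      IsRationalLine W p Φ₀ ∧ φ.IsPrimitive ∧ ψ.IsPrimitive ∧
      (∀ (σ : absoluteGaloisGroup ℚ), ∀ P ∈ Φ₀,
        σ • P = (φ ((modNCyclotomicCharacter ℚ m σ : (ZMod m)ˣ) : ZMod m)).val • P) ∧
      (∀ (σ : absoluteGaloisGroup ℚ) (P : geomTorsion W (p : ℤ)),
        σ • P - (ψ ((modNCyclotomicCharacter ℚ d σ : (ZMod d)ˣ) : ZMod d)).val • P ∈ Φ₀) := by
  obtain ⟨Φ₀, hΦ⟩ := exists_isRationalLine_of_not_irr W p hX.2.1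
  obtain ⟨m, im, φ, hφ, -, hφ0⟩ := ResidualLineCharacters.exists_character_sub hΦ
  obtain ⟨d, id, ψ, hψ, -, hψ0⟩ := ResidualLineCharacters.exists_character_quot hΦ
  exact ⟨Φ₀, m, im, φ, d, id, ψ, hΦ, hφ, hψ, hφ0, hψ0⟩

end Summit.BirchSwinnertonDyer.BirchSwinnertonDyer.Theorems.EisensteinPrimesMazurMCOnCellBTwistbackSubrowPartnerAnyLine

end
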